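import Literature.IUT.HodgeArakelov.BadPrimeGaussianMonoidsGaloisKummerHomProofs
import Literature.IUT.HodgeArakelov.BadPrimeGaussianMonoidsCohomologyModelProofs3
import Literature.IUT.HodgeArakelov.ThetaEnvDataRecordModel

/-!
# [IUTchII] Cor 3.5 (ii) "⥤" AT THE GENUINE RECORD `EtaleLevels.thetaEnvRecordKummer` (the Prop 3.1 input record of the
# NATURAL system `𝕄_*` of `X̲̲_K`, `Ψ_cns :=` the Kummer image of `𝒪^▷`): the Galois clause with EVERY junction hypothesis
# discharged — residual = the evaluation-sections DATA only (proof-only instantiation of `…GaloisKummerHomProofs.lean`)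

S. Mochizuki, *Inter-universal Teichmüller theory II*, kurims Dec-2020 manuscript, Cor 3.5 (ii) p. 95 ("each `Ψ_ξ(M^Θ_*)` is
equipped with a natural action by `G_v(M^Θ_*▶)_{⟨F_l^⋇⟩}`"), Prop 3.1 (i)(ii) pp. 87–88, Cor 2.4 (ii)(c) p. 70
[cite: Mochizuki2012, Cor 3.5 (ii) p.95]. Claim key DISPUTED (D-0012). PROOF-ONLY companion (abc-iut cell, layer L6, seat
abc-iut-w4-d004 gen 2; node **IUTchII:Cor3.5(ii)**, Galois clause; sub-DAG rows Cor-35.ii.r10 and P31.i.r2 = J1).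
NO definition, NO `Prop` fact.

THE INSTANCE (abc-iut-w4-d019 `ThetaEnvDataRecordModel.lean`): `E := EtaleLevels.thetaEnvRecordKummer … c hA hfi O ι₀` over
the genuine `Π^tp_{X̲̲}` data of [EtTh] §2 (abc-iut-L2 / abc-iut-L6-t1 `EtaleThetaDataOfSetting`): ambient module = the genuine
limit `lim_J H¹(Π^tp_{Ÿ̲̲} ∩ J, l·Δ_Θ)` (identity coefficient transport), `conj :=` the conjugation action
(`CohomologySystemOfContH1.h1LimConjMulAut`), `Ψ_cns :=` abc-iut-w4-d007's `h1LimKummerOn c hA hfi O` — the Kummer image of a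
`Π^tp_{X̲̲}`-stable constant monoid `O ≤ A` (`𝒪^▷_{k̄} ≤ k̄ˣ`) through the cyclotomic-rigidity coefficient datum `c`. The
identification data of `…SectionsProofs` / `…GaloisKummerActionProofs` are then TRIVIAL: `j := id`, `ψ :=` the tautological
`Additive (Multiplicative lim) ≃+ lim`, `hψ` by `rfl`, `Ψ_cns = mrange κ` by `rfl`, equivariance of `κ` =
`h1LimKummerOn_smul`, and "`θ` top-level" is STRUCTURAL (`toRecord_topClass`, identity transport).
* `mrange_pi_diagonalStable'_thetaEnvRecordKummer` — **the Galois clause of Cor 3.5 (ii) for the genuine record**: for every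
  `θ ∈ θ^ι_env(𝕄_*)` and every family of continuous evaluation SECTIONS `s_t : Π₀ ≅ G_v → Π^tp_{X̲̲}` with images in
  `Π^tp_{Ÿ̲̲}` (Cor 2.4 (ii)(c)), common coefficient action `φ₀`, sections of an augmentation `q` of `Π^tp_{X̲̲}` whose kernel
  acts trivially on `𝒪^▷` (the Galois action on `k̄` factors through `G_K`), the Gaussian monoid `Ψ_ξ = r(M^×_TM · θ^ℕ)`
  (restrictions `R_t` pinned to `h1LimCongr ∘ s_t^*`) is stable under the diagonal labeled `G_v`-action. NO junction
  hypothesis (`hsync`, `hstab`, `hs`, `hr`, `hfix`) remains; the identification is the TAUTOLOGICAL one (`j = id`,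
  `ψ = Additive (Multiplicative lim) ≃ lim`): its two bookkeeping equations are PROVED here — `conj_thetaEnvRecordKummer_apply`
  (`rfl`: `conj` of the record is the conjugation action read additively) and `topClass_thetaEnvRecordKummer` (every
  `θ ∈ θ^ι_env(𝕄_*)` is a top-level class: abc-iut-w4-d004 `toRecord_topClass` with the identity transport) — so that the
  headline `mrange_pi_diagonalStable'_thetaEnvRecordKummer_of_mem_thetaEnv` takes ONLY the data of the evaluation sections
  and the model (`c`, `O`, `hO`, `q`) and `θ ∈ θ^ι_env`; the binder form `mrange_pi_diagonalStable'_thetaEnvRecordKummer`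
  (any top-level `θ`) is kept as well.

Nothing here asserts a disputed claim or takes a side on [IUTchIII] Cor 3.12; typed ≠ proved ≠ endorsed.
-/

noncomputable section

namespace Literature.IUT.HodgeArakelov

namespace EtaleLevels

open Literature.AnabelianGeometry.EtaleTheta CohomologySystemOfContH1 EtaleThetaDataOfSetting TemperedThetaMonoids
  BadPrimeGaussianMonoids

variable {p : ℕ} [Fact p.Prime] {D : Literature.AnabelianGeometry.EtaleTheta.ThetaSetting p}
  {E : D.EtaleThetaData} {l : ℕ} (C : E.DoubleUnderline l) (hC : D.Compat) (hS : D.Sec2Hyps)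
  (hl : l.Prime) (hp2 : p ≠ 2) (hpl : p ≠ l) (hζ : ∃ ζ : D.K, IsPrimitiveRoot ζ (4 * l))
  (mods : ∀ M : ℕ+, D.CyclotomeMod l M)
  (f : contCocycles D.toTheta D.DeltaTheta C.GtpYdduu) (hf : f ∈ C.rootCocycles hC)
  (hmods : ∀ (M M' : ℕ+) (h : (M : ℕ) ∣ (M' : ℕ)) (x : D.lDeltaTheta l),
    MuN.red p M M' h ((mods M').red x) = (mods M).red x)
  (h15 : Literature.AnabelianGeometry.EtaleTheta.ThetaSetting.Prop15iii E hC) (L : C.CuspLabels)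
  (hZ : ∀ M : ℕ+, Nonempty (ModelCyclotomes.lDeltaQuot (C.rigidData (mods M) hC hS h15 L) ≃*
    Literature.IUT.HodgeTheaters.ZHat))
  (hcharY : EtaleThetaDataOfSetting.PiYddCharacteristic C)
  (hlim : Function.Bijective (rigidLimHom C hC hS hl hp2 hpl hζ mods f hf hmods h15 L hZ))
  [(EtaleThetaDataOfSetting.PiYdd C).Normal]
  {A : Type} [CommGroup A] [MulDistribMulAction (Pi C) A] [TopologicalSpace A] [RootableBy A ℕ]
  (c : CyclotomeCoefficients (phi C) (D.lDeltaTheta l) A)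
  (hA : ∀ b : A, IsOpen (MulAction.stabilizer (Pi C) b : Set (Pi C)))
  (hfi : ∀ b : A, (MulAction.stabilizer (Pi C) b).FiniteIndex)
  (O : Submonoid A) (hO : ∀ (σ : Pi C) (b : A), b ∈ O → σ • b ∈ O) (ι₀ : Pi C)
  {Lbl : Type*} {P₀ : TopGroup.{0}} (φ₀ : P₀ →* D.GtpTheta) (s : Lbl → (P₀ →* Pi C))
  (hι : ∀ t, Continuous ((MonoidHom.id (Pi C)).comp (s t)))
  (hN : ∀ t, (⊤ : Subgroup P₀).map ((MonoidHom.id (Pi C)).comp (s t)) ≤ PiYdd C)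
  (hφ : ∀ t, (phi C).comp ((MonoidHom.id (Pi C)).comp (s t)) = φ₀)

include hO in
/-- **IUTchII:Cor3.5(ii)** (kurims p.95) "each `Ψ_ξ(M^Θ_*)` is equipped with a natural action by `G_v(M^Θ_*▶)_{⟨F_l^⋇⟩}`"
**AT THE GENUINE RECORD** `thetaEnvRecordKummer` of the natural system `𝕄_*` of `X̲̲_K`: diagonal `G_v,⟨F_l^⋇⟩`-stability of
the Gaussian monoid `Ψ_ξ = r(M^×_TM · θ^ℕ)`, for `θ ∈ θ^ι_env`, label-wise continuous evaluation sections `s_t` into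
`Π^tp_{Ÿ̲̲}` with common coefficient action `φ₀`, sections of an augmentation `q` whose kernel acts trivially on `𝒪^▷`,
restrictions pinned to `h1LimCongr ∘ s_t^*` — every junction hypothesis of the Cor 3.5 (ii) family DISCHARGED, the
identification tautological (`hψ`, `hθtop` kept as `rfl`-shaped binders). [cite: Mochizuki2012, Cor 3.5 (ii) p.95] -/
theorem mrange_pi_diagonalStable'_thetaEnvRecordKummer
    {K : Type*} [Group K] (q : Pi C →* K) (hq : ∀ x : Pi C, q x = 1 → ∀ a ∈ O, x • a = a) (w : P₀ →* K)
    (hsec : ∀ t g, q (s t g) = w g)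
    (θ : (thetaEnvRecordKummer C hC hS hl hp2 hpl hζ mods f hf hmods h15 L hZ hcharY hlim c hA hfi O ι₀).H)
    (hθtop : AddEquiv.additiveMultiplicative (h1Lim (phi C) (D.lDeltaTheta l) (PiYdd C) ⊥) (Additive.ofMul θ) ∈
      Set.range ((cohomologySystemOfContH1 (phi C) (D.lDeltaTheta l) (PiYdd C)).toLim ⊤))
    (hψ : ∀ (g : Pi C)
      (y : (thetaEnvRecordKummer C hC hS hl hp2 hpl hζ mods f hf hmods h15 L hZ hcharY hlim c hA hfi O ι₀).H),
      AddEquiv.additiveMultiplicative (h1Lim (phi C) (D.lDeltaTheta l) (PiYdd C) ⊥) (Additive.ofMul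
        ((thetaEnvRecordKummer C hC hS hl hp2 hpl hζ mods f hf hmods h15 L hZ hcharY hlim c hA hfi O ι₀).conj g y)) =
        h1LimConj (phi C) (D.lDeltaTheta l) (PiYdd C) g (AddEquiv.additiveMultiplicative (h1Lim (phi C) (D.lDeltaTheta l) (PiYdd C) ⊥) (Additive.ofMul y)))
    (R : Lbl → ((thetaEnvRecordKummer C hC hS hl hp2 hpl hζ mods f hf hmods h15 L hZ hcharY hlim c hA hfi O ι₀).H →*
      Multiplicative (h1Lim φ₀ (D.lDeltaTheta l) (⊤ : Subgroup P₀) ⊥)))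
    (hR : ∀ t y, Multiplicative.toAdd (R t y) =
      h1LimCongr (D.lDeltaTheta l) ⊤ (hφ t) ⊥
        (h1LimComap (phi C) (D.lDeltaTheta l) ((MonoidHom.id (Pi C)).comp (s t)) (hι t) (hN t)
          (AddEquiv.additiveMultiplicative (h1Lim (phi C) (D.lDeltaTheta l) (PiYdd C) ⊥) (Additive.ofMul y))))
    (t₀ : Lbl) (g : P₀) :
    (MonoidHom.mrange (MonoidHom.pi fun t =>
        (R t).comp (splitMonoid
          (thetaEnvRecordKummer C hC hS hl hp2 hpl hζ mods f hf hmods h15 L hZ hcharY hlim c hA hfi O ι₀).units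
          (Submonoid.powers θ)).subtype)).map
        (piIso Lbl (h1LimConjMulAut φ₀ (D.lDeltaTheta l) ⊤ g)).toMonoidHom =
      MonoidHom.mrange (MonoidHom.pi fun t =>
        (R t).comp (splitMonoid
          (thetaEnvRecordKummer C hC hS hl hp2 hpl hζ mods f hf hmods h15 L hZ hcharY hlim c hA hfi O ι₀).units
          (Submonoid.powers θ)).subtype) :=
  mrange_pi_diagonalStable'_ofKummerHom_labelwise
    (thetaEnvRecordKummer C hC hS hl hp2 hpl hζ mods f hf hmods h15 L hZ hcharY hlim c hA hfi O ι₀)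
    (MulDistribMulAction.toMulAut (Pi C) A) O (fun σ b hb => hO σ b hb)
    (h1LimKummerOn (phi C) (D.lDeltaTheta l) (PiYdd C) c hA hfi O) (phi C) φ₀ (D.lDeltaTheta l) (PiYdd C)
    (MonoidHom.id (Pi C)) (AddEquiv.additiveMultiplicative (h1Lim (phi C) (D.lDeltaTheta l) (PiYdd C) ⊥)) s hι hN hφ
    (ThetaEnvData.toRecord_constantMonoid _ _ _ _)
    (fun (σ : Pi C) m => h1LimKummerOn_smul (phi C) (D.lDeltaTheta l) (PiYdd C) c hA hfi O σ m
      ⟨σ • (m : A), hO σ m m.2⟩ rfl)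
    q (fun x hx a ha => hq x hx a ha) w hsec (fun g y => hψ g y) θ hθtop R hR t₀ g

/-- Bookkeeping, PROVED: the conjugation datum of the genuine record IS the conjugation action `h1LimConj` read through the
tautological identification `Additive (Multiplicative lim) ≃ lim` (`rfl`). [cite: Mochizuki2012, Prop 3.1 (i) p.87] -/
theorem conj_thetaEnvRecordKummer_apply (g : Pi C)
    (y : (thetaEnvRecordKummer C hC hS hl hp2 hpl hζ mods f hf hmods h15 L hZ hcharY hlim c hA hfi O ι₀).H) :
    AddEquiv.additiveMultiplicative (h1Lim (phi C) (D.lDeltaTheta l) (PiYdd C) ⊥) (Additive.ofMul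
      ((thetaEnvRecordKummer C hC hS hl hp2 hpl hζ mods f hf hmods h15 L hZ hcharY hlim c hA hfi O ι₀).conj g y)) =
      h1LimConj (phi C) (D.lDeltaTheta l) (PiYdd C) g
        (AddEquiv.additiveMultiplicative (h1Lim (phi C) (D.lDeltaTheta l) (PiYdd C) ⊥) (Additive.ofMul y)) := rfl

/-- Bookkeeping, PROVED: every `θ ∈ θ^ι_env(𝕄_*)` of the genuine record is a TOP-LEVEL class of
`lim_J H¹(Π^tp_{Ÿ̲̲} ∩ J, l·Δ_Θ)` (abc-iut-w4-d004 `toRecord_topClass`; identity coefficient transport).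
[cite: Mochizuki2012, Prop 1.5 (iii) p.30] -/
theorem topClass_thetaEnvRecordKummer {i₀ : Pi C}
    {θ : (thetaEnvRecordKummer C hC hS hl hp2 hpl hζ mods f hf hmods h15 L hZ hcharY hlim c hA hfi O ι₀).H}
    (hθ : θ ∈ (thetaEnvRecordKummer C hC hS hl hp2 hpl hζ mods f hf hmods h15 L hZ hcharY hlim c hA hfi O ι₀).thetaEnv i₀) :
    AddEquiv.additiveMultiplicative (h1Lim (phi C) (D.lDeltaTheta l) (PiYdd C) ⊥) (Additive.ofMul θ) ∈
      Set.range ((cohomologySystemOfContH1 (phi C) (D.lDeltaTheta l) (PiYdd C)).toLim ⊤) :=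
  toRecord_topClass (thetaEnvData C hC hS hl hp2 hpl hζ mods f hf hmods h15 L hZ hcharY hlim)
    (CohomologySystemOfContH1.h1LimConjMulAut (phi C) (D.lDeltaTheta l) (PiYdd C))
    (h1LimKummerOn (phi C) (D.lDeltaTheta l) (PiYdd C) c hA hfi O)
    (fun g : Pi C => h1LimConjEquiv (phi C) (D.lDeltaTheta l) (PiYdd C) (g * ι₀ * g⁻¹))
    (phi C) (D.lDeltaTheta l) (PiYdd C)
    (AddEquiv.additiveMultiplicative (h1Lim (phi C) (D.lDeltaTheta l) (PiYdd C) ⊥)) (fun y _ => ⟨y, rfl⟩) hθ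

include hO in
/-- **IUTchII:Cor3.5(ii)** (kurims p.95) **AT THE GENUINE RECORD, structural form**: for EVERY `θ ∈ θ^ι_env(𝕄_*)` of
`thetaEnvRecordKummer`, the Gaussian monoid `Ψ_ξ = r(M^×_TM · θ^ℕ)` is stable under the diagonal labeled `G_v`-action —
inputs = the DATA of the label-wise evaluation sections (`s_t` continuous into `Π^tp_{Ÿ̲̲}`, common `φ₀`, sections of an
augmentation `q` whose kernel acts trivially on `𝒪^▷`, restrictions pinned) and of the model (`c`, `O`, `hO`); no junction,
identification or bookkeeping hypothesis remains. [cite: Mochizuki2012, Cor 3.5 (ii) p.95] -/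
theorem mrange_pi_diagonalStable'_thetaEnvRecordKummer_of_mem_thetaEnv
    {K : Type*} [Group K] (q : Pi C →* K) (hq : ∀ x : Pi C, q x = 1 → ∀ a ∈ O, x • a = a) (w : P₀ →* K)
    (hsec : ∀ t g, q (s t g) = w g) {i₀ : Pi C}
    {θ : (thetaEnvRecordKummer C hC hS hl hp2 hpl hζ mods f hf hmods h15 L hZ hcharY hlim c hA hfi O ι₀).H}
    (hθ : θ ∈ (thetaEnvRecordKummer C hC hS hl hp2 hpl hζ mods f hf hmods h15 L hZ hcharY hlim c hA hfi O ι₀).thetaEnv i₀)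
    (R : Lbl → ((thetaEnvRecordKummer C hC hS hl hp2 hpl hζ mods f hf hmods h15 L hZ hcharY hlim c hA hfi O ι₀).H →*
      Multiplicative (h1Lim φ₀ (D.lDeltaTheta l) (⊤ : Subgroup P₀) ⊥)))
    (hR : ∀ t y, Multiplicative.toAdd (R t y) =
      h1LimCongr (D.lDeltaTheta l) ⊤ (hφ t) ⊥
        (h1LimComap (phi C) (D.lDeltaTheta l) ((MonoidHom.id (Pi C)).comp (s t)) (hι t) (hN t)
          (AddEquiv.additiveMultiplicative (h1Lim (phi C) (D.lDeltaTheta l) (PiYdd C) ⊥) (Additive.ofMul y))))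
    (t₀ : Lbl) (g : P₀) :
    (MonoidHom.mrange (MonoidHom.pi fun t =>
        (R t).comp (splitMonoid
          (thetaEnvRecordKummer C hC hS hl hp2 hpl hζ mods f hf hmods h15 L hZ hcharY hlim c hA hfi O ι₀).units
          (Submonoid.powers θ)).subtype)).map
        (piIso Lbl (h1LimConjMulAut φ₀ (D.lDeltaTheta l) ⊤ g)).toMonoidHom =
      MonoidHom.mrange (MonoidHom.pi fun t =>
        (R t).comp (splitMonoid
          (thetaEnvRecordKummer C hC hS hl hp2 hpl hζ mods f hf hmods h15 L hZ hcharY hlim c hA hfi O ι₀).units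
          (Submonoid.powers θ)).subtype) :=
  mrange_pi_diagonalStable'_thetaEnvRecordKummer C hC hS hl hp2 hpl hζ mods f hf hmods h15 L hZ hcharY hlim c hA hfi O
    hO ι₀ φ₀ s hι hN hφ q hq w hsec θ
    (topClass_thetaEnvRecordKummer C hC hS hl hp2 hpl hζ mods f hf hmods h15 L hZ hcharY hlim c hA hfi O ι₀ hθ)
    (conj_thetaEnvRecordKummer_apply C hC hS hl hp2 hpl hζ mods f hf hmods h15 L hZ hcharY hlim c hA hfi O ι₀) R hR t₀ g

end EtaleLevels

end Literature.IUT.HodgeArakelov
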